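import Literature.MathematicalPhysics.QuantumFieldTheory.Balaban1983to89.B9Thm31SiteGpGradDecayReg335Y
import Literature.MathematicalPhysics.QuantumFieldTheory.Balaban1983to89.B9Thm31SiteAgmonWeightPar

/-!
# `Balaban1983to89.B9Thm31SiteGpGradDecayPar` — T. Bałaban, *Propagators for lattice gauge theories in a background field*, Commun. Math. Phys. **99** (1985)
# 389–434 [Balaban1985BackgroundPropagators] Thm 3.1 (3.46) p. 398 (the entry `ζ∇_UG′(U)`), by S. Agmon's method [Agmon1982]: ★★ **THE `L²`-LOCAL DECAY OF
# `∇_U G′(U; par)` AT A GENERIC SITE TRANSPORTER FROM THE THREE TRANSPORTER LAWS** — dag-n06-w1's `B9Thm31SiteGpGradDecayReg335Y` §2 re-pressed over `par` (link 3 of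
# the CASCADE-K re-press of the (3.46)₄ chain; links 1–2 = `B9Thm31SiteGpDecayPar`, `B9Thm31SiteAgmonWeightPar`)

statement-level skeleton of published theorems with citation tags; proofs where landed; nothing here is a claim about the Yang–Mills mass gap

WHY THIS FILE.  w1's file proves (3.46b) for `G′ = GpY i (parSymY i)` on the class (3.35); its §1 (energy ≤ form, the per-bond algebra of the weighted gradient) is
transporter-generic and reused BY NAME; §2's arithmetic hard-wires the coercivity constant `1∕8` (`grad_arith`: prefactor `160 = 20·8`).  THIS FILE: ★ `grad_arith_par`
(the same arithmetic at a coercivity constant `κ₀ ∈ (0, 1]` with the budgets `κ, θ ≤ κ₀∕2`: prefactor `20·κ₀⁻¹`), ★★★ `hs_restrict_cdS_GpY_le_par` —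
`Σ_{z∈A}Σ_μ HS((∇_{U,μ}G′(U; par)Ψ)(z)) ≤ 20κ₀⁻¹·((L^{j_B})²∕W²)·‖Ψ‖²₁` under w1's weight hypotheses with the budget `(d+1)θ_b + θ_s∕2 ≤ κ₀∕2`, the legs `G`-valued, the
inverse-symmetry and the level-weighted coercivity `κ₀` DISPLAYED — and ★★ `hs_restrict_cdS_GpY_le_exp_par` (the Agmon weight `e^{δρ}` at a PARAMETRIC rate `δ` with
`δ²(2(d+1) + (d+1)²) ≤ κ₀∕2`: prefactor `20κ₀⁻¹·(L^{j_B})²∕(e^{δr})²`).  Proofs: w1's, verbatim up to the constants.  At `par := parSymY, κ₀ := 1∕8` these are w1's statements.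
HONEST SCOPE.  One finite lattice operator at a time, laws displayed, constants explicit; NOT a node discharge; count-neutral; nothing continuum ∕ OS ∕ mass gap ∕ Clay.
Cell `pub-ymgap` (D-0062), Track A node N06 [B9], seat `pub-ymgap-dag-n06-l` (g37), 2026-08-30; NEW file; nothing landed is modified.
-/

noncomputable section

namespace Literature.MathematicalPhysics.QuantumFieldTheory.Balaban1983to89.B9Thm31SiteGpGradDecayPar

open Literature.MathematicalPhysics.QuantumFieldTheory.Balaban1983to89
open Node00 B6KLevelCensusIndexV1 B6Geom246MultiLevelBox B6MultiLevelBoxOperator B6MultiLevelTorusOperator B6GlobalChartV1 B9BackgroundsKLevelV1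
  B9Eq39Adjoint B9Thm311ReadingCoords B9Thm311DeltaPrimePos B9Ineq369CurvatureSmallAtLettersY B9Thm31SiteCoerciveGaugeBlockY
  B9Thm31SiteCoerciveReg335Y B9Thm31SiteGpBoundsReg335Y B9Thm31SitePolarisedFormY B9Thm31SiteConjugatedFormY B9Thm31SiteGpDecayReg335Y
  B9Thm31SiteAgmonWeightY B9Thm31SiteGpGradDecayReg335Y B9Thm31SiteGpDecayPar B9Thm31SiteAgmonWeightPar
open Literature.MathematicalPhysics.QuantumFieldTheory.Balaban1983to89.B9Thm311FlippedBondLetters (hs_real_smul)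
open scoped Matrix Matrix.Norms.L2Operator

variable {d ℓ : ℕ} {hd : 1 ≤ d + 1} {hL : Odd (ℓ + 1) ∧ 1 < ℓ + 1} {b₀ b₁ : ℝ}
variable (i : KIdx d ℓ hd hL b₀ b₁) {N : ℕ} {G : Subgroup (Matrix (Fin N) (Fin N) ℂ)ˣ} (par : SiteParY (Matrix (Fin N) (Fin N) ℂ) i)

/-- THE ARITHMETIC OF §2 AT A COERCIVITY CONSTANT `κ₀ ∈ (0, 1]`: `E ≤ X + κM`, `S ≤ 2E + 6θM`, `W²P ≤ S`, `κ, θ ≤ κ₀∕2`, `(κ₀ − κ)M ≤ X`, `(κ₀ − κ)L_B⁻¹X ≤ Q`, `M ≥ 0`,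
`W, L_B > 0` ⇒ `P ≤ 20κ₀⁻¹·(L_B∕W²)·Q` (w1's `grad_arith` at `κ₀ = 1∕8`). [cite: Agmon1982, Ch.1, bookkeeping] -/
theorem grad_arith_par {E X M S P Q W LB κ θ κ₀ : ℝ} (hκ₀ : 0 < κ₀) (hE : E ≤ X + κ * M) (hS : S ≤ 2 * E + 6 * θ * M) (hP : W ^ 2 * P ≤ S)
    (hκ : κ ≤ κ₀ / 2) (hθ : θ ≤ κ₀ / 2) (hiX : (κ₀ - κ) * M ≤ X) (hXQ : (κ₀ - κ) * LB⁻¹ * X ≤ Q) (hM0 : 0 ≤ M) (hW : 0 < W) (hLB : 0 < LB) :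
    P ≤ 20 * κ₀⁻¹ * (LB / W ^ 2) * Q := by
  have hc : κ₀ / 2 ≤ κ₀ - κ := by linarith
  have hc0 : 0 < κ₀ - κ := lt_of_lt_of_le (by positivity) hc
  have hX0 : 0 ≤ X := le_trans (mul_nonneg hc0.le hM0) hiX
  have hMX : κ₀ * M ≤ 2 * X := by nlinarith
  have hκM : κ * M ≤ (κ₀ / 2) * M := mul_le_mul_of_nonneg_right hκ hM0
  have hθM : θ * M ≤ (κ₀ / 2) * M := mul_le_mul_of_nonneg_right hθ hM0
  have hS' : S ≤ 10 * X := by nlinarith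
  have h1 : (κ₀ - κ) * X ≤ LB * Q := by
    have h := mul_le_mul_of_nonneg_left hXQ hLB.le
    rwa [show LB * ((κ₀ - κ) * LB⁻¹ * X) = (κ₀ - κ) * X by field_simp] at h
  have hXQ' : κ₀ * X ≤ 2 * (LB * Q) := by nlinarith
  have hX' : X ≤ κ₀⁻¹ * (2 * (LB * Q)) := by
    have h := mul_le_mul_of_nonneg_left hXQ' (inv_nonneg.2 hκ₀.le)
    rwa [← mul_assoc, inv_mul_cancel₀ hκ₀.ne', one_mul] at h
  have hW2 : 0 < W ^ 2 := by positivity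
  have h3 : W ^ 2 * P ≤ 20 * κ₀⁻¹ * (LB * Q) :=
    calc W ^ 2 * P ≤ 10 * X := hP.trans hS'
      _ ≤ 10 * (κ₀⁻¹ * (2 * (LB * Q))) := mul_le_mul_of_nonneg_left hX' (by norm_num)
      _ = 20 * κ₀⁻¹ * (LB * Q) := by ring
  calc P = (W ^ 2)⁻¹ * (W ^ 2 * P) := by rw [← mul_assoc, inv_mul_cancel₀ hW2.ne', one_mul]
    _ ≤ (W ^ 2)⁻¹ * (20 * κ₀⁻¹ * (LB * Q)) := mul_le_mul_of_nonneg_left h3 (inv_nonneg.2 hW2.le)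
    _ = 20 * κ₀⁻¹ * (LB / W ^ 2) * Q := by rw [div_eq_mul_inv]; ring

/-- ★★★ **THE `L²`-LOCAL DECAY OF `∇_U G′(U; par)` FROM THE THREE TRANSPORTER LAWS — (3.46b)'s SHAPE.**  Hypotheses as link 1's `hs_restrict_GpY_le_par` (legs `G`-valued,
inverse-symmetry, level-weighted coercivity `κ₀ ∈ (0, 1]`; weight `ω` with `ω = 1` on `B ⊇ supp Ψ`, `ω ≥ W > 0` on `A`, bond ratios `q ≤ θ_b·(L^{lev})⁻²` at both ends,
block oscillation `q ≤ θ_s`, `(d+1)θ_b + θ_s∕2 ≤ κ₀∕2`, levels `≤ j_B` on `B`) plus `0 ≤ θ_b`, `0 ≤ θ_s`.  THEN `Σ_{z∈A}Σ_μ HS((∇_{U,μ}G′(U; par)Ψ)(z)) ≤ 20κ₀⁻¹·((L^{j_B})²∕W²)·‖Ψ‖²₁`.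
[cite: Balaban1985BackgroundPropagators, Thm 3.1 (3.46) p.398; Agmon1982, Ch.1, Thm 1.5] -/
theorem hs_restrict_cdS_GpY_le_par [Nonempty (Fin N)] (hG : G ≤ B7Prop2Explicit.unitaryUnits (Matrix (Fin N) (Fin N) ℂ))
    {U : CfgY (Matrix (Fin N) (Fin N) ℂ) i} (hU : ∀ μ x, U μ x ∈ G) (hpar : ∀ z w : SiteY i, par U z w ∈ G)
    (hinv : ∀ z z' : SiteY i, par U z z' = (par U z' z)⁻¹) {κ₀ : ℝ} (hκ₀ : 0 < κ₀) (hκ₀1 : κ₀ ≤ 1)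
    (hcoer : ∀ Φ : SiteY i → Matrix (Fin N) (Fin N) ℂ,
      κ₀ * ∑ z : SiteY i, (((((ℓ + 1) ^ (blkOf i.D.toDomains z).1.1 : ℕ) : ℝ)) ^ 2)⁻¹ * ∑ a, ∑ b, ‖Φ z a b‖ ^ 2 ≤ trIP (fun _ => (1 : ℝ)) Φ (deltaPrimeAY i par U Φ))
    {ω : SiteY i → ℝ} (hω : ∀ z, 0 < ω z) {θb θs : ℝ} (hθb0 : 0 ≤ θb) (hθs0 : 0 ≤ θs)
    (hb1 : ∀ μ z, ω (shiftY i μ z) / ω z + ω z / ω (shiftY i μ z) - 2 ≤ θb * (((((ℓ + 1) ^ (blkOf i.D.toDomains z).1.1 : ℕ) : ℝ)) ^ 2)⁻¹)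
    (hb2 : ∀ μ z, ω (shiftY i μ z) / ω z + ω z / ω (shiftY i μ z) - 2 ≤ θb * (((((ℓ + 1) ^ (blkOf i.D.toDomains (shiftY i μ z)).1.1 : ℕ) : ℝ)) ^ 2)⁻¹)
    (hs : ∀ z w : SiteY i, blkOf i.D.toDomains w = blkOf i.D.toDomains z → ω z / ω w + ω w / ω z - 2 ≤ θs)
    (hκ : ((d : ℝ) + 1) * θb + θs / 2 ≤ κ₀ / 2)
    {A B : Finset (SiteY i)} {Ψ : SiteY i → Matrix (Fin N) (Fin N) ℂ} (hΨ : ∀ z, z ∉ B → Ψ z = 0) (hωB : ∀ z ∈ B, ω z = 1)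
    {jB : ℕ} (hjB : ∀ z ∈ B, (blkOf i.D.toDomains z).1.1 ≤ jB) {W : ℝ} (hW0 : 0 < W) (hW : ∀ z ∈ A, W ≤ ω z) :
    ∑ z ∈ A, ∑ μ : Fin (d + 1), ∑ a, ∑ b, ‖cdS i U μ (GpY i par U Ψ) z a b‖ ^ 2
      ≤ 20 * κ₀⁻¹ * (((((ℓ + 1) ^ jB : ℕ) : ℝ)) ^ 2 / W ^ 2) * trIP (fun _ => (1 : ℝ)) Ψ Ψ := by
  have hd0 : (0 : ℝ) ≤ d := Nat.cast_nonneg d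
  have hθ : ((d : ℝ) + 1) * θb ≤ κ₀ / 2 := by linarith
  have hθb1 : θb ≤ 1 := by nlinarith
  have hm1 : ∀ z : SiteY i, (((((ℓ + 1) ^ (blkOf i.D.toDomains z).1.1 : ℕ) : ℝ)) ^ 2)⁻¹ ≤ 1 := fun z => by
    have h1 : (1 : ℝ) ≤ (((ℓ + 1) ^ (blkOf i.D.toDomains z).1.1 : ℕ) : ℝ) := by exact_mod_cast Nat.one_le_pow _ _ (Nat.succ_pos ℓ)
    exact inv_le_one_of_one_le₀ (by nlinarith)
  have hM0 : 0 ≤ ∑ z : SiteY i, (((((ℓ + 1) ^ (blkOf i.D.toDomains z).1.1 : ℕ) : ℝ)) ^ 2)⁻¹ * ∑ a, ∑ b, ‖(((ω z : ℝ) : ℂ) • GpY i par U Ψ z) a b‖ ^ 2 :=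
    Finset.sum_nonneg fun z _ => mul_nonneg (inv_nonneg.2 (by positivity)) (hs_nonneg _)
  -- Agmon's two readings (link 1)
  have hiX := levelMass_wsmul_GpY_le_pairing_par i par hG hU hpar hinv hκ₀ hcoer hω hb1 hb2 hs hΨ hωB
  have hXQ := pairing_GpY_le_of_support_par i par hG hU hpar hinv hκ₀ hcoer hω hb1 hb2 hs hκ hΨ hωB hjB
  -- the energy of the weighted field: `E ≤ ⟨Φ′, Δ′Φ′⟩ ≤ conj + κM = X + κM`
  have hE : ∑ μ : Fin (d + 1), trIP (fun _ => (1 : ℝ)) (cdS i U μ (fun w => ((ω w : ℝ) : ℂ) • GpY i par U Ψ w))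
        (cdS i U μ (fun w => ((ω w : ℝ) : ℂ) • GpY i par U Ψ w))
      ≤ trIP (fun _ => (1 : ℝ)) (GpY i par U Ψ) Ψ + (((d : ℝ) + 1) * θb + θs / 2) *
          ∑ z : SiteY i, (((((ℓ + 1) ^ (blkOf i.D.toDomains z).1.1 : ℕ) : ℝ)) ^ 2)⁻¹ * ∑ a, ∑ b, ‖(((ω z : ℝ) : ℂ) • GpY i par U Ψ z) a b‖ ^ 2 := by
    have h1 := sum_trIP_cdS_le_trIP_deltaPrimeAY i hG par U hinv hpar hU (fun w => ((ω w : ℝ) : ℂ) • GpY i par U Ψ w)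
    have h2 := trIP_wsmul_deltaPrimeAY_winv_ge i hG par U hinv hpar hU hω hb1 hb2 hs (fun w => ((ω w : ℝ) : ℂ) • GpY i par U Ψ w)
    rw [conj_wsmul_GpY_eq_pairing_par i par (isUnit_deltaPrimeAY_of_coer i par hκ₀ hcoer) hω hΨ hωB] at h2
    linarith
  -- the per-bond algebra, summed: `Σ_zΣ_μ ω_z²HS(∇Φ z) ≤ 2E + 6(d+1)θ_b M`
  have hdef : ∀ μ z, (ω (shiftY i μ z) - ω z) ^ 2 * ∑ a, ∑ b, ‖GpY i par U Ψ (shiftY i μ z) a b‖ ^ 2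
      ≤ 3 * θb * ((((((ℓ + 1) ^ (blkOf i.D.toDomains (shiftY i μ z)).1.1 : ℕ) : ℝ)) ^ 2)⁻¹ *
          ∑ a, ∑ b, ‖(((ω (shiftY i μ z) : ℝ) : ℂ) • GpY i par U Ψ (shiftY i μ z)) a b‖ ^ 2) := by
    intro μ z
    have hθm : θb * (((((ℓ + 1) ^ (blkOf i.D.toDomains (shiftY i μ z)).1.1 : ℕ) : ℝ)) ^ 2)⁻¹ ≤ 1 := by
      have h0 : (0 : ℝ) ≤ (((((ℓ + 1) ^ (blkOf i.D.toDomains (shiftY i μ z)).1.1 : ℕ) : ℝ)) ^ 2)⁻¹ := inv_nonneg.2 (by positivity)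
      nlinarith [hm1 (shiftY i μ z)]
    have h := sq_sub_le_of_q_le (hω (shiftY i μ z)) (hω z) (hb2 μ z) hθm
    rw [hs_real_smul]
    have hX' := hs_nonneg (GpY i par U Ψ (shiftY i μ z))
    calc (ω (shiftY i μ z) - ω z) ^ 2 * ∑ a, ∑ b, ‖GpY i par U Ψ (shiftY i μ z) a b‖ ^ 2
        ≤ (3 * (θb * (((((ℓ + 1) ^ (blkOf i.D.toDomains (shiftY i μ z)).1.1 : ℕ) : ℝ)) ^ 2)⁻¹) * ω (shiftY i μ z) ^ 2) *
            ∑ a, ∑ b, ‖GpY i par U Ψ (shiftY i μ z) a b‖ ^ 2 := mul_le_mul_of_nonneg_right h hX'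
      _ = _ := by ring
  have hsum : ∑ z : SiteY i, ∑ μ : Fin (d + 1), ω z ^ 2 * ∑ a, ∑ b, ‖cdS i U μ (GpY i par U Ψ) z a b‖ ^ 2
      ≤ 2 * ∑ μ : Fin (d + 1), trIP (fun _ => (1 : ℝ)) (cdS i U μ (fun w => ((ω w : ℝ) : ℂ) • GpY i par U Ψ w))
            (cdS i U μ (fun w => ((ω w : ℝ) : ℂ) • GpY i par U Ψ w))
        + 6 * (((d : ℝ) + 1) * θb) *
          ∑ z : SiteY i, (((((ℓ + 1) ^ (blkOf i.D.toDomains z).1.1 : ℕ) : ℝ)) ^ 2)⁻¹ * ∑ a, ∑ b, ‖(((ω z : ℝ) : ℂ) • GpY i par U Ψ z) a b‖ ^ 2 := by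
    rw [Finset.sum_comm]
    have hμ : ∀ μ : Fin (d + 1), ∑ z : SiteY i, ω z ^ 2 * ∑ a, ∑ b, ‖cdS i U μ (GpY i par U Ψ) z a b‖ ^ 2
        ≤ 2 * trIP (fun _ => (1 : ℝ)) (cdS i U μ (fun w => ((ω w : ℝ) : ℂ) • GpY i par U Ψ w))
            (cdS i U μ (fun w => ((ω w : ℝ) : ℂ) • GpY i par U Ψ w))
          + 6 * θb * ∑ z : SiteY i, (((((ℓ + 1) ^ (blkOf i.D.toDomains z).1.1 : ℕ) : ℝ)) ^ 2)⁻¹ *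
              ∑ a, ∑ b, ‖(((ω z : ℝ) : ℂ) • GpY i par U Ψ z) a b‖ ^ 2 := by
      intro μ
      have hz : ∀ z, ω z ^ 2 * ∑ a, ∑ b, ‖cdS i U μ (GpY i par U Ψ) z a b‖ ^ 2
          ≤ 2 * ∑ a, ∑ b, ‖cdS i U μ (fun w => ((ω w : ℝ) : ℂ) • GpY i par U Ψ w) z a b‖ ^ 2
            + 2 * (3 * θb * ((((((ℓ + 1) ^ (blkOf i.D.toDomains (shiftY i μ z)).1.1 : ℕ) : ℝ)) ^ 2)⁻¹ *
                ∑ a, ∑ b, ‖(((ω (shiftY i μ z) : ℝ) : ℂ) • GpY i par U Ψ (shiftY i μ z)) a b‖ ^ 2)) := by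
        intro z
        have h1 := hs_wsmul_cdS_le i hG hU μ ω (GpY i par U Ψ) z
        have h2 := hdef μ z
        linarith
      refine (Finset.sum_le_sum fun z _ => hz z).trans (le_of_eq ?_)
      rw [Finset.sum_add_distrib, ← Finset.mul_sum, ← Finset.mul_sum, trIP_one_self_eq,
        Equiv.sum_comp (shiftY i μ) (fun z => 3 * θb * ((((((ℓ + 1) ^ (blkOf i.D.toDomains z).1.1 : ℕ) : ℝ)) ^ 2)⁻¹ *
          ∑ a, ∑ b, ‖(((ω z : ℝ) : ℂ) • GpY i par U Ψ z) a b‖ ^ 2)), ← Finset.mul_sum]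
      ring
    calc ∑ μ : Fin (d + 1), ∑ z : SiteY i, ω z ^ 2 * ∑ a, ∑ b, ‖cdS i U μ (GpY i par U Ψ) z a b‖ ^ 2
        ≤ ∑ μ : Fin (d + 1), (2 * trIP (fun _ => (1 : ℝ)) (cdS i U μ (fun w => ((ω w : ℝ) : ℂ) • GpY i par U Ψ w))
              (cdS i U μ (fun w => ((ω w : ℝ) : ℂ) • GpY i par U Ψ w))
            + 6 * θb * ∑ z : SiteY i, (((((ℓ + 1) ^ (blkOf i.D.toDomains z).1.1 : ℕ) : ℝ)) ^ 2)⁻¹ *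
                ∑ a, ∑ b, ‖(((ω z : ℝ) : ℂ) • GpY i par U Ψ z) a b‖ ^ 2) := Finset.sum_le_sum fun μ _ => hμ μ
      _ = _ := by
          rw [Finset.sum_add_distrib, ← Finset.mul_sum, Finset.sum_const, Finset.card_univ, Fintype.card_fin, nsmul_eq_mul]; push_cast; ring
  -- restrict to `A`, where `ω ≥ W`
  have hPA : W ^ 2 * ∑ z ∈ A, ∑ μ : Fin (d + 1), ∑ a, ∑ b, ‖cdS i U μ (GpY i par U Ψ) z a b‖ ^ 2
      ≤ ∑ z : SiteY i, ∑ μ : Fin (d + 1), ω z ^ 2 * ∑ a, ∑ b, ‖cdS i U μ (GpY i par U Ψ) z a b‖ ^ 2 := by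
    rw [Finset.mul_sum]
    have hterm : ∀ z, 0 ≤ ∑ μ : Fin (d + 1), ω z ^ 2 * ∑ a, ∑ b, ‖cdS i U μ (GpY i par U Ψ) z a b‖ ^ 2 :=
      fun z => Finset.sum_nonneg fun μ _ => mul_nonneg (sq_nonneg _) (hs_nonneg _)
    refine le_trans (Finset.sum_le_sum fun z hz => ?_) (Finset.sum_le_univ_sum_of_nonneg hterm)
    rw [Finset.mul_sum]
    exact Finset.sum_le_sum fun μ _ => mul_le_mul_of_nonneg_right (pow_le_pow_left₀ hW0.le (hW z hz) 2) (hs_nonneg _)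
  exact grad_arith_par hκ₀ hE hsum hPA hκ hθ hiX hXQ hM0 hW0 (by positivity)

/-- ★★ **(3.46b) AT A GENERIC TRANSPORTER WITH THE AGMON WEIGHT `e^{δρ}` AT A PARAMETRIC RATE**: `ρ` with `|ρ(z+e_μ) − ρ z| ≤ (L^{lev})⁻¹` at both ends of every bond,
`|ρ z − ρ w| ≤ d+1` on every block of `𝔅`, `ρ = 0` on `B ⊇ supp Ψ`, `ρ ≥ r` on `A`, levels `≤ j_B` on `B`; `0 ≤ δ ≤ 1`, `δ(d+1) ≤ 1`, `δ²(2(d+1) + (d+1)²) ≤ κ₀∕2`: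
`Σ_{z∈A}Σ_μ HS((∇_{U,μ}G′(U; par)Ψ)(z)) ≤ 20κ₀⁻¹·((L^{j_B})²∕(e^{δr})²)·‖Ψ‖²₁`. [cite: Balaban1985BackgroundPropagators, Thm 3.1 (3.46) p.398; Agmon1982, Ch.1, Thm 1.5] -/
theorem hs_restrict_cdS_GpY_le_exp_par [Nonempty (Fin N)] (hG : G ≤ B7Prop2Explicit.unitaryUnits (Matrix (Fin N) (Fin N) ℂ))
    {U : CfgY (Matrix (Fin N) (Fin N) ℂ) i} (hU : ∀ μ x, U μ x ∈ G) (hpar : ∀ z w : SiteY i, par U z w ∈ G)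
    (hinv : ∀ z z' : SiteY i, par U z z' = (par U z' z)⁻¹) {κ₀ : ℝ} (hκ₀ : 0 < κ₀) (hκ₀1 : κ₀ ≤ 1)
    (hcoer : ∀ Φ : SiteY i → Matrix (Fin N) (Fin N) ℂ,
      κ₀ * ∑ z : SiteY i, (((((ℓ + 1) ^ (blkOf i.D.toDomains z).1.1 : ℕ) : ℝ)) ^ 2)⁻¹ * ∑ a, ∑ b, ‖Φ z a b‖ ^ 2 ≤ trIP (fun _ => (1 : ℝ)) Φ (deltaPrimeAY i par U Φ))
    {δ : ℝ} (hδ0 : 0 ≤ δ) (hδ1 : δ ≤ 1) (hδD : δ * ((d : ℝ) + 1) ≤ 1) (hδκ : δ ^ 2 * (2 * ((d : ℝ) + 1) + ((d : ℝ) + 1) ^ 2) ≤ κ₀ / 2)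
    {ρ : SiteY i → ℝ}
    (hρ1 : ∀ μ z, |ρ (shiftY i μ z) - ρ z| ≤ ((((ℓ + 1) ^ (blkOf i.D.toDomains z).1.1 : ℕ) : ℝ))⁻¹)
    (hρ2 : ∀ μ z, |ρ (shiftY i μ z) - ρ z| ≤ ((((ℓ + 1) ^ (blkOf i.D.toDomains (shiftY i μ z)).1.1 : ℕ) : ℝ))⁻¹)
    (hρD : ∀ z w : SiteY i, blkOf i.D.toDomains w = blkOf i.D.toDomains z → |ρ z - ρ w| ≤ (d : ℝ) + 1)
    {A B : Finset (SiteY i)} {Ψ : SiteY i → Matrix (Fin N) (Fin N) ℂ} (hΨ : ∀ z, z ∉ B → Ψ z = 0) (hρB : ∀ z ∈ B, ρ z = 0)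
    {jB : ℕ} (hjB : ∀ z ∈ B, (blkOf i.D.toDomains z).1.1 ≤ jB) {r : ℝ} (hr : ∀ z ∈ A, r ≤ ρ z) :
    ∑ z ∈ A, ∑ μ : Fin (d + 1), ∑ a, ∑ b, ‖cdS i U μ (GpY i par U Ψ) z a b‖ ^ 2
      ≤ 20 * κ₀⁻¹ * (((((ℓ + 1) ^ jB : ℕ) : ℝ)) ^ 2 / Real.exp (δ * r) ^ 2) * trIP (fun _ => (1 : ℝ)) Ψ Ψ := by
  have hδκ' : ((d : ℝ) + 1) * (2 * δ ^ 2) + (2 * δ ^ 2 * ((d : ℝ) + 1) ^ 2) / 2 ≤ κ₀ / 2 := by nlinarith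
  have hω : ∀ z, 0 < Real.exp (δ * ρ z) := fun z => Real.exp_pos _
  have hωB : ∀ z ∈ B, Real.exp (δ * ρ z) = 1 := fun z hz => by rw [hρB z hz, mul_zero, Real.exp_zero]
  have hW : ∀ z ∈ A, Real.exp (δ * r) ≤ Real.exp (δ * ρ z) := fun z hz => Real.exp_le_exp.2 (mul_le_mul_of_nonneg_left (hr z hz) hδ0)
  exact hs_restrict_cdS_GpY_le_par i par hG hU hpar hinv hκ₀ hκ₀1 hcoer hω (by positivity) (by positivity)
    (fun μ z => bondRatio_exp_le i hδ0 hδ1 μ z (hρ1 μ z)) (fun μ z => bondRatio_exp_le' i hδ0 hδ1 μ z (hρ2 μ z))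
    (fun z w hzw => blockOsc_exp_le i hδ0 hδD z w (hρD z w hzw)) hδκ' hΨ hωB hjB (Real.exp_pos _) hW

end Literature.MathematicalPhysics.QuantumFieldTheory.Balaban1983to89.B9Thm31SiteGpGradDecayPar

end
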